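import Literature.Analysis.FluidPDE.ElgindiAngularHardyGamma
import Literature.Analysis.FluidPDE.ElgindiProductRule
import Literature.Analysis.FluidPDE.ElgindiEllipticClassicalSolution
import Literature.Analysis.FluidPDE.ElgindiWordLocality
import Mathlib.MeasureTheory.Function.ConvergenceInMeasure
import HarnessLib

/-!
# The `𝓗⁴`-closure of the test functions: Fatou, and the extension of the test-function estimates
([Elgindi2021] Remark 8.3: "the class `C_c^∞((0,∞)×(0,π/2))` is dense in `𝓗ᵏ`")

Topic `Literature/Analysis/FluidPDE`. Support file (definitions with bodies and proved theorems, no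
named facts) on the proof path of the named fact
`Literature.Analysis.FluidPDE.Elgindi.ElgindiGhoulMasmoudi2021_stabilityCore`
(`ElgindiStabilityDecomposition.lean`). T. M. Elgindi, Ann. of Math. 194 (2021) =
arXiv:1904.04795, §8.1 Remark 8.3 and Corollary 8.2/8.4, Lemma 8.5 (p. 25); Elgindi–Ghoul–Masmoudi,
arXiv:1910.14071, §9 Proposition 9.2 (p. 20).

`HkApprox α f fs`: `f ∈ C^∞(strip)` and test functions `fs n` with `|fs n − f|²_{𝓗⁴} → 0` (the
faithful class of the papers: the `𝓗⁴`-closure of `C_c^∞`; a function constant in `θ` near the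
boundary has a finite functional but is *not* in this class). Along a subsequence all words
`D_θ^iD_z^j(fs n)`, `i + j ≤ 4`, converge a.e. on the strip to those of `f` (`exists_subseq_ae`);
Fatou then transfers the test-function inequalities: the product rule
`|fg|²_{𝓗⁴} ≤ (4K/(γ−1))|f|²|g|²` (`eHkNormSq_mul_le_closure`) and the `γ`-Hardy bound for the
radial words (`lintegral_radialWord_le_closure`).
-/

noncomputable section

open MeasureTheory Set Function Real Filter Finset
open _root_.Topology
open scoped ENNReal ContDiff

namespace Literature.Analysis.FluidPDE

namespace Elgindi

/-! ### The Leibniz formula on the strip for strip-smooth functions -/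

/-- **`D_θ^iD_z^j(fg)` on the strip for `f, g ∈ C^∞(strip)`**: the double binomial formula
(pointwise on the strip, by localisation to global smooth functions). [folklore] -/
theorem iterate_Dθ_Dz_mul_strip {f g : ℝ → ℝ → ℝ} (hf : ContDiffOn ℝ ∞ (uncurry f) strip) (hg : ContDiffOn ℝ ∞ (uncurry g) strip)
    (i j : ℕ) {p : ℝ × ℝ} (hp : p ∈ strip) :
    (Dθ^[i] (Dz^[j] (f * g))) p.1 p.2 = ∑ k ∈ range (j + 1), ∑ l ∈ range (i + 1),
      ((j.choose k : ℝ) * (i.choose l : ℝ)) * ((Dθ^[l] (Dz^[k] f)) p.1 p.2 * (Dθ^[i - l] (Dz^[j - k] g)) p.1 p.2) := by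
  obtain ⟨Wf, ft, hWf, hpWf, hWfS, hft, -, -, hEqf⟩ := exists_test_eqOn hf isCompact_singleton (singleton_subset_iff.2 hp)
  obtain ⟨Wg, gt, hWg, hpWg, hWgS, hgt, -, -, hEqg⟩ := exists_test_eqOn hg isCompact_singleton (singleton_subset_iff.2 hp)
  set W := Wf ∩ Wg
  have hW : IsOpen W := hWf.inter hWg
  have hpW : p ∈ W := ⟨hpWf (mem_singleton p), hpWg (mem_singleton p)⟩
  set fc : ℝ → ℝ → ℝ := fun R θ => ft (R, θ)
  set gc : ℝ → ℝ → ℝ := fun R θ => gt (R, θ)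
  have hfc : Smooth2 fc := fun n => by have := contDiff_infty.1 hft n; exact this
  have hgc : Smooth2 gc := fun n => by have := contDiff_infty.1 hgt n; exact this
  have ef : ∀ q ∈ W, f q.1 q.2 = fc q.1 q.2 := fun q hq => (hEqf hq.1).symm
  have eg : ∀ q ∈ W, g q.1 q.2 = gc q.1 q.2 := fun q hq => (hEqg hq.2).symm
  have efg : ∀ q ∈ W, (f * g) q.1 q.2 = (fc * gc) q.1 q.2 := fun q hq => by
    show f q.1 q.2 * g q.1 q.2 = fc q.1 q.2 * gc q.1 q.2; rw [ef q hq, eg q hq]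
  -- words of functions equal on the open `W` agree on `W`
  have hloc : ∀ {u v : ℝ → ℝ → ℝ}, (∀ q ∈ W, u q.1 q.2 = v q.1 q.2) → ∀ a b, ∀ q ∈ W, (Dθ^[a] (Dz^[b] u)) q.1 q.2 = (Dθ^[a] (Dz^[b] v)) q.1 q.2 :=
    fun huv a b => iterate_Dθ_congr_open hW (iterate_Dz_congr_open hW huv b) a
  rw [hloc efg i j p hpW, iterate_Dθ_Dz_mul_apply hfc hgc i j p.1 p.2]
  refine Finset.sum_congr rfl fun k _ => Finset.sum_congr rfl fun l _ => ?_
  rw [hloc ef l k p hpW, hloc eg (i - l) (j - k) p hpW]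

/-! ### The closure class -/

/-- **Approximation by test functions in the `𝓗⁴` functional**: `f ∈ C^∞(strip)` and test
functions `fs n` with `|fs n − f|²_{𝓗⁴} → 0`. [cite: Elgindi2021, §8.1 Remark 8.3 (p. 25 of arXiv:1904.04795)] -/
structure HkApprox (α : ℝ) (f : ℝ → ℝ → ℝ) (fs : ℕ → ℝ → ℝ → ℝ) : Prop where
  smooth : ContDiffOn ℝ ∞ (uncurry f) strip
  test : ∀ n, StripTest (fs n)
  conv : Tendsto (fun n => eHkNormSq α 4 (fs n - f)) atTop (𝓝 0)

/-- The weight of the word `(i,j)`: `w/s^{η/2}` for `i = 0`, `W = w·s^{−γ/2}` for `i ≥ 1`. [folklore] -/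
def wordWeight (α : ℝ) (i : ℕ) (z θ : ℝ) : ℝ := if i = 0 then hWeight z θ else totalWeight α z θ

/-- The weighted word, `hkRadialTerm` for `i = 0` and `hkMixedTerm` for `i ≥ 1`. [folklore] -/
theorem eL2Sq_weighted_word_le (α : ℝ) {i j : ℕ} (hij : i + j ≤ 4) (g : ℝ → ℝ → ℝ) :
    eL2Sq (fun z θ => (Dθ^[i] (Dz^[j] g)) z θ * wordWeight α i z θ) ≤ eHkNormSq α 4 g := by
  by_cases hi : i = 0
  · subst hi
    have e : (fun z θ => (Dθ^[0] (Dz^[j] g)) z θ * wordWeight α 0 z θ) = hkRadialTerm j g := by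
      funext z θ; simp [wordWeight, hkRadialTerm]
    rw [e]; exact eL2Sq_hkRadialTerm_le α (by omega) g
  · have e : (fun z θ => (Dθ^[i] (Dz^[j] g)) z θ * wordWeight α i z θ) = hkMixedTerm α i j g := by
      funext z θ; simp [wordWeight, hkMixedTerm, hi]
    rw [e]; exact eL2Sq_hkMixedTerm_le α (Nat.one_le_iff_ne_zero.2 hi) hij g

/-- The word weight is positive on the strip. [folklore] -/
theorem wordWeight_pos (α : ℝ) (i : ℕ) {p : ℝ × ℝ} (hp : p ∈ strip) : 0 < wordWeight α i p.1 p.2 := by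
  unfold wordWeight
  split_ifs
  · unfold hWeight
    exact div_pos (radialWeight_pos hp.1) (Real.rpow_pos_of_pos (Real.sin_pos_of_pos_of_lt_pi (by linarith [hp.2.1]) (by linarith [hp.2.2])) _)
  · unfold totalWeight; exact mul_pos (radialWeight_pos hp.1) (thetaWeight_pos α hp.2)

/-- The word weight is continuous on the strip. [folklore] -/
theorem continuousOn_wordWeight (α : ℝ) (i : ℕ) : ContinuousOn (fun p : ℝ × ℝ => wordWeight α i p.1 p.2) strip := by
  by_cases hi : i = 0
  · simp only [wordWeight, hi, ↓reduceIte]; exact continuousOn_hWeight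
  · simp only [wordWeight, hi, ↓reduceIte]; exact continuousOn_totalWeight α

/-- Test functions have a finite `𝓗⁴` functional. [folklore] -/
theorem StripTest.eHkNormSq_lt_top {α : ℝ} {u : ℝ → ℝ → ℝ} (hu : StripTest u) : eHkNormSq α 4 u < ⊤ := by
  -- every term is the integral of a continuous compactly supported function
  have hterm : ∀ i j, eL2Sq (fun z θ => (Dθ^[i] (Dz^[j] u)) z θ * wordWeight α i z θ) < ⊤ := by
    intro i j
    have hw := hu.ofWord i j
    obtain ⟨a, b, ha, hab, hrad⟩ := exists_radial_bounds' hw.supp hw.sub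
    obtain ⟨c, d, hc, hd, hca⟩ : ∃ c d : ℝ, 0 < c ∧ d < π / 2 ∧ ∀ p : ℝ × ℝ, (Dθ^[i] (Dz^[j] u)) p.1 p.2 ≠ 0 → c ≤ p.2 ∧ p.2 ≤ d := by
      by_cases hne : (tsupport (uncurry (Dθ^[i] (Dz^[j] u)))).Nonempty
      · have hK := hw.supp.isCompact
        obtain ⟨p₀, hp₀, hmin⟩ := hK.exists_isMinOn hne continuous_snd.continuousOn
        obtain ⟨p₁, hp₁, hmax⟩ := hK.exists_isMaxOn hne continuous_snd.continuousOn
        refine ⟨p₀.2, p₁.2, (hw.sub hp₀).2.1, (hw.sub hp₁).2.2, fun p hp => ?_⟩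
        have hmem : p ∈ tsupport (uncurry (Dθ^[i] (Dz^[j] u))) := subset_tsupport _ (show uncurry (Dθ^[i] (Dz^[j] u)) p ≠ 0 from hp)
        exact ⟨hmin hmem, hmax hmem⟩
      · refine ⟨π / 4, π / 4, by positivity, by linarith [Real.pi_pos], fun p hp => absurd ?_ hne⟩
        exact ⟨p, subset_tsupport _ (show uncurry (Dθ^[i] (Dz^[j] u)) p ≠ 0 from hp)⟩
    -- bound the integrand by a constant on its support, which has finite measure inside the strip
    have hK : IsCompact (Icc a b ×ˢ Icc c d) := isCompact_Icc.prod isCompact_Icc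
    have hKS : Icc a b ×ˢ Icc c d ⊆ strip := fun p hp => ⟨ha.trans_le hp.1.1, hc.trans_le hp.2.1, hp.2.2.trans_lt hd⟩
    have hcont : ContinuousOn (fun p : ℝ × ℝ => ((Dθ^[i] (Dz^[j] u)) p.1 p.2 * wordWeight α i p.1 p.2) ^ 2) (Icc a b ×ˢ Icc c d) :=
      (((hw.smooth 0).continuous.continuousOn.mul ((continuousOn_wordWeight α i).mono hKS)).pow 2)
    obtain ⟨B, hB⟩ := hK.exists_bound_of_continuousOn hcont
    rw [eL2Sq_eq_lintegral_ofReal]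
    have hle : ∀ p ∈ strip, ENNReal.ofReal (((Dθ^[i] (Dz^[j] u)) p.1 p.2 * wordWeight α i p.1 p.2) ^ 2) ≤
        (Icc a b ×ˢ Icc c d).indicator (fun _ => ENNReal.ofReal B) p := by
      intro p hp
      by_cases hmem : p ∈ Icc a b ×ˢ Icc c d
      · rw [indicator_of_mem hmem]
        refine ENNReal.ofReal_le_ofReal ?_
        have := hB p hmem; rw [Real.norm_eq_abs, abs_of_nonneg (sq_nonneg _)] at this; exact this
      · rw [indicator_of_notMem hmem]
        have h0 : (Dθ^[i] (Dz^[j] u)) p.1 p.2 = 0 := by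
          by_contra h
          exact hmem ⟨hrad p.1 p.2 h, hca p h⟩
        simp [h0]
    calc ∫⁻ p in strip, ENNReal.ofReal (((Dθ^[i] (Dz^[j] u)) p.1 p.2 * wordWeight α i p.1 p.2) ^ 2)
        ≤ ∫⁻ p in strip, (Icc a b ×ˢ Icc c d).indicator (fun _ => ENNReal.ofReal B) p := setLIntegral_mono' measurableSet_strip hle
      _ ≤ ∫⁻ p, (Icc a b ×ˢ Icc c d).indicator (fun _ => ENNReal.ofReal B) p := lintegral_mono' Measure.restrict_le_self le_rfl
      _ = ENNReal.ofReal B * volume (Icc a b ×ˢ Icc c d) := by rw [lintegral_indicator_const (measurableSet_Icc.prod measurableSet_Icc)]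
      _ < ⊤ := ENNReal.mul_lt_top ENNReal.ofReal_lt_top hK.measure_lt_top
  unfold eHkNormSq
  refine ENNReal.add_lt_top.2 ⟨ENNReal.sum_lt_top.2 fun j hj => ?_, ENNReal.sum_lt_top.2 fun i _ => ENNReal.sum_lt_top.2 fun j _ => ?_⟩
  · have := hterm 0 j
    have e : (fun z θ => (Dθ^[0] (Dz^[j] u)) z θ * wordWeight α 0 z θ) = hkRadialTerm j u := by
      funext z θ; simp [wordWeight, hkRadialTerm]
    rw [e] at this; exact this
  · split_ifs with h
    · have := hterm i j
      have hi : i ≠ 0 := by omega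
      have e : (fun z θ => (Dθ^[i] (Dz^[j] u)) z θ * wordWeight α i z θ) = hkMixedTerm α i j u := by
        funext z θ; simp [wordWeight, hkMixedTerm, hi]
      rw [e] at this; exact this
    · exact ENNReal.zero_lt_top

namespace HkApprox

variable {α : ℝ} {f : ℝ → ℝ → ℝ} {fs : ℕ → ℝ → ℝ → ℝ} (hA : HkApprox α f fs)
include hA

/-- **Elements of the closure have a finite `𝓗⁴` functional.** [folklore] -/
theorem eHkNormSq_lt_top : eHkNormSq α 4 f < ⊤ := by
  -- `E(f) ≤ 2E(fs n) + 2E(fs n − f)` with the second term eventually `< 1`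
  have hev := (hA.conv.eventually (gt_mem_nhds (show (0:ℝ≥0∞) < 1 by norm_num)))
  obtain ⟨n, hn⟩ := hev.exists
  have h4 : (4 : WithTop ℕ∞) ≤ ((⊤ : ℕ∞) : WithTop ℕ∞) := WithTop.coe_le_coe.2 le_top
  have hfs4 : ContDiffOn ℝ 4 (uncurry (fs n)) strip := ((hA.test n).smooth 4).contDiffOn
  have hdiff : ContDiffOn ℝ 4 (uncurry (f - fs n)) strip := ((hA.smooth.of_le h4).sub hfs4).congr fun p _ => rfl
  have e : f = fs n + (f - fs n) := by funext z θ; simp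
  have hle := eHkNormSq_add_le (α := α) hfs4 hdiff
  rw [← e] at hle
  have hsym : eHkNormSq α 4 (f - fs n) = eHkNormSq α 4 (fs n - f) := by
    rw [show f - fs n = (-1 : ℝ) • (fs n - f) by funext z θ; simp, eHkNormSq_smul]; simp
  rw [hsym] at hle
  refine hle.trans_lt (ENNReal.add_lt_top.2 ⟨ENNReal.mul_lt_top (by norm_num) (hA.test n).eHkNormSq_lt_top, ENNReal.mul_lt_top (by norm_num) (hn.trans ENNReal.one_lt_top)⟩)

/-- Subsequences of approximating sequences approximate. [folklore] -/
theorem subseq {ns : ℕ → ℕ} (hns : StrictMono ns) : HkApprox α f (fs ∘ ns) :=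
  ⟨hA.smooth, fun n => hA.test (ns n), hA.conv.comp hns.tendsto_atTop⟩

/-- **Convergence in measure of every weighted word.** [folklore] -/
theorem tendstoInMeasure_word {i j : ℕ} (hij : i + j ≤ 4) :
    TendstoInMeasure (volume.restrict strip) (fun n (p : ℝ × ℝ) => (Dθ^[i] (Dz^[j] (fs n))) p.1 p.2 * wordWeight α i p.1 p.2) atTop
      (fun p => (Dθ^[i] (Dz^[j] f)) p.1 p.2 * wordWeight α i p.1 p.2) := by
  have h4 : (4 : WithTop ℕ∞) ≤ ((⊤ : ℕ∞) : WithTop ℕ∞) := WithTop.coe_le_coe.2 le_top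
  refine tendstoInMeasure_of_ne_top fun ε hε hεtop => ?_
  -- Chebyshev with the squared difference
  set D : ℕ → ℝ × ℝ → ℝ≥0∞ := fun n p => ENNReal.ofReal ((((Dθ^[i] (Dz^[j] (fs n))) p.1 p.2 - (Dθ^[i] (Dz^[j] f)) p.1 p.2) * wordWeight α i p.1 p.2) ^ 2)
  have hDm : ∀ n, AEMeasurable (D n) (volume.restrict strip) := by
    intro n
    have c1 : ContinuousOn (fun p : ℝ × ℝ => (Dθ^[i] (Dz^[j] (fs n))) p.1 p.2) strip := ((hA.test n).smooth.ofWord i j 0).continuous.continuousOn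
    have c2 : ContinuousOn (fun p : ℝ × ℝ => (Dθ^[i] (Dz^[j] f)) p.1 p.2) strip := continuousOn_iterate_Dθ_Dz (hA.smooth.of_le h4) hij
    exact ((((c1.sub c2).mul (continuousOn_wordWeight α i)).pow 2).aemeasurable measurableSet_strip).ennreal_ofReal
  have hDint : ∀ n, ∫⁻ p in strip, D n p ≤ eHkNormSq α 4 (fs n - f) := by
    intro n
    have hsub := iterate_Dθ_Dz_sub (((hA.test n).smooth 4).contDiffOn) (hA.smooth.of_le h4) hij
    calc ∫⁻ p in strip, D n p = eL2Sq (fun z θ => (Dθ^[i] (Dz^[j] (fs n - f))) z θ * wordWeight α i z θ) := by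
          rw [eL2Sq_eq_lintegral_ofReal]
          refine setLIntegral_congr_fun measurableSet_strip fun p hp => ?_
          simp only [D]; rw [hsub p hp]
      _ ≤ eHkNormSq α 4 (fs n - f) := eL2Sq_weighted_word_le α hij _
  have hcheb : ∀ n, (volume.restrict strip) {p | ε ≤ edist ((Dθ^[i] (Dz^[j] (fs n))) p.1 p.2 * wordWeight α i p.1 p.2) ((Dθ^[i] (Dz^[j] f)) p.1 p.2 * wordWeight α i p.1 p.2)} ≤
      eHkNormSq α 4 (fs n - f) / ε ^ 2 := by
    intro n
    have hε2 : ε ^ 2 ≠ 0 := pow_ne_zero 2 hε.ne'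
    have hε2' : ε ^ 2 ≠ ⊤ := ENNReal.pow_ne_top hεtop
    refine le_trans ?_ ((meas_ge_le_lintegral_div (hDm n) hε2 hε2').trans (ENNReal.div_le_div_right (hDint n) _))
    refine measure_mono fun p hp => ?_
    simp only [mem_setOf_eq] at hp ⊢
    simp only [D]
    rw [edist_dist, Real.dist_eq] at hp
    have hεr : ε = ENNReal.ofReal ε.toReal := (ENNReal.ofReal_toReal hεtop).symm
    rw [hεr] at hp ⊢
    have h0 : 0 ≤ ε.toReal := ENNReal.toReal_nonneg
    have hle : ε.toReal ≤ |(Dθ^[i] (Dz^[j] (fs n))) p.1 p.2 * wordWeight α i p.1 p.2 - (Dθ^[i] (Dz^[j] f)) p.1 p.2 * wordWeight α i p.1 p.2| :=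
      (ENNReal.ofReal_le_ofReal_iff (abs_nonneg _)).1 hp
    rw [← ENNReal.ofReal_pow h0]
    refine ENNReal.ofReal_le_ofReal ?_
    rw [← sq_abs (( _ - _) * _), show ((Dθ^[i] (Dz^[j] (fs n))) p.1 p.2 - (Dθ^[i] (Dz^[j] f)) p.1 p.2) * wordWeight α i p.1 p.2 =
      (Dθ^[i] (Dz^[j] (fs n))) p.1 p.2 * wordWeight α i p.1 p.2 - (Dθ^[i] (Dz^[j] f)) p.1 p.2 * wordWeight α i p.1 p.2 by ring]
    exact pow_le_pow_left₀ h0 hle 2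
  have hlim : Tendsto (fun n => eHkNormSq α 4 (fs n - f) / ε ^ 2) atTop (𝓝 0) := by
    have := ENNReal.Tendsto.div_const hA.conv (Or.inr (pow_ne_zero 2 hε.ne'))
    rwa [ENNReal.zero_div] at this
  exact tendsto_of_tendsto_of_tendsto_of_le_of_le tendsto_const_nhds hlim (fun _ => bot_le) hcheb

/-- **An a.e.-convergent subsequence for all the words at once.** [folklore] -/
theorem exists_subseq_ae : ∃ ns : ℕ → ℕ, StrictMono ns ∧ ∀ᵐ p ∂(volume.restrict strip), ∀ i j, i + j ≤ 4 →
    Tendsto (fun k => (Dθ^[i] (Dz^[j] (fs (ns k)))) p.1 p.2) atTop (𝓝 ((Dθ^[i] (Dz^[j] f)) p.1 p.2)) := by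
  -- the finite set of words
  set T : Finset (ℕ × ℕ) := (range 5 ×ˢ range 5).filter fun w => w.1 + w.2 ≤ 4 with hT
  -- induction over finite sets of words, for all approximating families
  have key : ∀ (S : Finset (ℕ × ℕ)), (∀ w ∈ S, w.1 + w.2 ≤ 4) → ∀ (gs : ℕ → ℝ → ℝ → ℝ), HkApprox α f gs →
      ∃ ns : ℕ → ℕ, StrictMono ns ∧ ∀ᵐ p ∂(volume.restrict strip), ∀ w ∈ S,
        Tendsto (fun k => (Dθ^[w.1] (Dz^[w.2] (gs (ns k)))) p.1 p.2) atTop (𝓝 ((Dθ^[w.1] (Dz^[w.2] f)) p.1 p.2)) := by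
    intro S
    induction S using Finset.induction_on with
    | empty => intro _ gs _; exact ⟨id, strictMono_id, ae_of_all _ fun p w hw => absurd hw (Finset.notMem_empty w)⟩
    | insert w S hwS ih =>
      intro hS gs hgs
      obtain ⟨ns₁, hns₁, hae₁⟩ := ih (fun w' hw' => hS w' (Finset.mem_insert_of_mem hw')) gs hgs
      have hgs₁ : HkApprox α f (gs ∘ ns₁) := hgs.subseq hns₁
      have hm := hgs₁.tendstoInMeasure_word (i := w.1) (j := w.2) (hS w (Finset.mem_insert_self w S))
      obtain ⟨ns₂, hns₂, hae₂⟩ := hm.exists_seq_tendsto_ae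
      refine ⟨ns₁ ∘ ns₂, hns₁.comp hns₂, ?_⟩
      filter_upwards [hae₁, hae₂, (ae_restrict_iff' measurableSet_strip).2 (ae_of_all _ fun p (hp : p ∈ strip) => wordWeight_pos α w.1 hp)] with p h1 h2 hpos
      intro w' hw'
      rcases Finset.mem_insert.1 hw' with rfl | hw'S
      · -- divide by the positive weight
        have hc : wordWeight α w'.1 p.1 p.2 ≠ 0 := hpos.ne'
        have := h2.mul_const (wordWeight α w'.1 p.1 p.2)⁻¹
        simp only [Function.comp, mul_assoc, mul_inv_cancel₀ hc, mul_one] at this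
        exact this
      · exact (h1 w' hw'S).comp hns₂.tendsto_atTop
  obtain ⟨ns, hns, hae⟩ := key T (fun w hw => by rw [hT, Finset.mem_filter] at hw; exact hw.2) fs hA
  refine ⟨ns, hns, ?_⟩
  filter_upwards [hae] with p hp
  intro i j hij
  exact hp (i, j) (by rw [hT, Finset.mem_filter, Finset.mem_product, Finset.mem_range, Finset.mem_range]; exact ⟨⟨by omega, by omega⟩, hij⟩)

end HkApprox

/-! ### Fatou under a.e. convergence of the words -/

/-- **Fatou for the `𝓗⁴` functional under a.e. convergence on the strip.** [folklore] -/
theorem eHkNormSq_le_liminf_ae (α : ℝ) {g : ℝ → ℝ → ℝ} {gs : ℕ → ℝ → ℝ → ℝ} (hg : ContDiffOn ℝ 4 (uncurry g) strip)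
    (hgs : ∀ n, ContDiffOn ℝ 4 (uncurry (gs n)) strip)
    (hlim : ∀ᵐ p ∂(volume.restrict strip), ∀ i j, i + j ≤ 4 → Tendsto (fun n => (Dθ^[i] (Dz^[j] (gs n))) p.1 p.2) atTop (𝓝 ((Dθ^[i] (Dz^[j] g)) p.1 p.2))) :
    eHkNormSq α 4 g ≤ liminf (fun n => eHkNormSq α 4 (gs n)) atTop := by
  rw [eHkNormSq_eq_lintegral_hkDensity α hg]
  simp_rw [eHkNormSq_eq_lintegral_hkDensity α (hgs _)]
  have hpt : ∀ᵐ p ∂(volume.restrict strip), Tendsto (fun n => hkDensity α 4 (gs n) p) atTop (𝓝 (hkDensity α 4 g p)) := by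
    filter_upwards [hlim] with p hp
    unfold hkDensity
    refine Tendsto.add (tendsto_finsetSum _ fun j hj => ?_) (tendsto_finsetSum _ fun i _ => tendsto_finsetSum _ fun j _ => ?_)
    · have hj' : j ≤ 4 := Nat.lt_succ_iff.1 (mem_range.1 hj)
      have h0 := hp 0 j (by omega)
      simp only [Function.iterate_zero, id_eq] at h0
      exact ENNReal.tendsto_ofReal ((h0.mul_const (hWeight p.1 p.2)).pow 2)
    · by_cases h : 1 ≤ i ∧ i + j ≤ 4
      · simp only [h, and_self, if_true]
        exact ENNReal.tendsto_ofReal (((hp i j h.2).mul_const (totalWeight α p.1 p.2)).pow 2)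
      · simp only [h, if_false]; exact tendsto_const_nhds
  have hmeas : ∀ n, AEMeasurable (hkDensity α 4 (gs n)) (volume.restrict strip) := by
    intro n
    unfold hkDensity
    have a1 : AEMeasurable (fun p : ℝ × ℝ => ∑ j ∈ range (4 + 1), ENNReal.ofReal ((hkRadialTerm j (gs n) p.1 p.2) ^ 2)) (volume.restrict strip) :=
      Finset.aemeasurable_sum (range (4 + 1)) (f := fun j (p : ℝ × ℝ) => ENNReal.ofReal ((hkRadialTerm j (gs n) p.1 p.2) ^ 2))
        (fun j hj => ((aemeasurable_hkRadialTerm_strip (hgs n) (Nat.lt_succ_iff.1 (mem_range.1 hj))).pow_const 2).ennreal_ofReal) |>.congr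
        (ae_of_all _ fun p => by simp [Finset.sum_apply])
    have a2 : AEMeasurable (fun p : ℝ × ℝ => ∑ i ∈ range (4 + 1), ∑ j ∈ range (4 + 1),
        if 1 ≤ i ∧ i + j ≤ 4 then ENNReal.ofReal ((hkMixedTerm α i j (gs n) p.1 p.2) ^ 2) else 0) (volume.restrict strip) := by
      refine Finset.aemeasurable_sum (range (4 + 1)) (f := fun i (p : ℝ × ℝ) => ∑ j ∈ range (4 + 1),
        if 1 ≤ i ∧ i + j ≤ 4 then ENNReal.ofReal ((hkMixedTerm α i j (gs n) p.1 p.2) ^ 2) else 0) (fun i _ => ?_) |>.congr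
        (ae_of_all _ fun p => by simp [Finset.sum_apply])
      refine Finset.aemeasurable_sum (range (4 + 1)) (f := fun j (p : ℝ × ℝ) =>
        if 1 ≤ i ∧ i + j ≤ 4 then ENNReal.ofReal ((hkMixedTerm α i j (gs n) p.1 p.2) ^ 2) else 0) (fun j _ => ?_) |>.congr
        (ae_of_all _ fun p => by simp [Finset.sum_apply])
      by_cases h : 1 ≤ i ∧ i + j ≤ 4
      · simp only [h, and_self, if_true]
        exact ((aemeasurable_hkMixedTerm_strip α (hgs n) h.2).pow_const 2).ennreal_ofReal
      · simp only [h, if_false]; exact aemeasurable_const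
    exact a1.add a2
  calc ∫⁻ p in strip, hkDensity α 4 g p
      = ∫⁻ p in strip, liminf (fun n => hkDensity α 4 (gs n) p) atTop := lintegral_congr_ae (by
          filter_upwards [hpt] with p hp; exact hp.liminf_eq.symm)
    _ ≤ liminf (fun n => ∫⁻ p in strip, hkDensity α 4 (gs n) p) atTop := lintegral_liminf_le' hmeas

/-! ### Extension of the test-function estimates to the closure -/

/-- Products of test functions are test functions. [folklore] -/
theorem StripTest.mul {u v : ℝ → ℝ → ℝ} (hu : StripTest u) (hv : StripTest v) : StripTest (u * v) :=
  ⟨hu.smooth.ofMul hv.smooth, hu.supp.mul_right, (tsupport_mul_subset_left (f := uncurry u) (g := uncurry v)).trans hu.sub⟩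

/-- `limsup`-control of the functional along an approximating sequence: `E(fs n) ≤ 2E(f) + 2E(fs n − f)`. [folklore] -/
theorem HkApprox.eHkNormSq_approx_le {α : ℝ} {f : ℝ → ℝ → ℝ} {fs : ℕ → ℝ → ℝ → ℝ} (hA : HkApprox α f fs) (n : ℕ) :
    eHkNormSq α 4 (fs n) ≤ 2 * eHkNormSq α 4 f + 2 * eHkNormSq α 4 (fs n - f) := by
  have h4 : (4 : WithTop ℕ∞) ≤ ((⊤ : ℕ∞) : WithTop ℕ∞) := WithTop.coe_le_coe.2 le_top
  have hf4 : ContDiffOn ℝ 4 (uncurry f) strip := hA.smooth.of_le h4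
  have hd : ContDiffOn ℝ 4 (uncurry (fs n - f)) strip := ((((hA.test n).smooth 4).contDiffOn).sub hf4).congr fun p _ => rfl
  have e : fs n = f + (fs n - f) := by funext z θ; simp
  have := eHkNormSq_add_le (α := α) hf4 hd
  rw [← e] at this
  exact this

/-- The limit of the right-hand sides `c·(2E f + 2ε_n)(2E g + 2δ_n)`. [folklore] -/
theorem tendsto_rhs_mul {a b c : ℝ≥0∞} (ha : a ≠ ⊤) (hb : b ≠ ⊤) (hc : c ≠ ⊤) {ε δ : ℕ → ℝ≥0∞} (hε : Tendsto ε atTop (𝓝 0)) (hδ : Tendsto δ atTop (𝓝 0)) :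
    Tendsto (fun n => c * ((2 * a + 2 * ε n) * (2 * b + 2 * δ n))) atTop (𝓝 (c * ((2 * a) * (2 * b)))) := by
  have h1 : Tendsto (fun n => 2 * a + 2 * ε n) atTop (𝓝 (2 * a + 2 * 0)) :=
    tendsto_const_nhds.add (ENNReal.Tendsto.const_mul hε (Or.inr (by norm_num)))
  have h2 : Tendsto (fun n => 2 * b + 2 * δ n) atTop (𝓝 (2 * b + 2 * 0)) :=
    tendsto_const_nhds.add (ENNReal.Tendsto.const_mul hδ (Or.inr (by norm_num)))
  rw [mul_zero, add_zero] at h1 h2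
  have ha2 : 2 * a ≠ ⊤ := ENNReal.mul_ne_top (by norm_num) ha
  have hb2 : 2 * b ≠ ⊤ := ENNReal.mul_ne_top (by norm_num) hb
  have h12 := ENNReal.Tendsto.mul h1 (Or.inr hb2) h2 (Or.inr ha2)
  exact ENNReal.Tendsto.const_mul h12 (Or.inr hc)

/-- **The product rule on the closure** (Elgindi Lemma 8.5 / EGM Proposition 9.2, `k = 4`):
`|fg|²_{𝓗⁴} ≤ 4K/(γ−1)·|f|²_{𝓗⁴}|g|²_{𝓗⁴}` for `f, g` in the `𝓗⁴`-closure of the test functions,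
`0 < α ≤ 10`. [cite: ElgindiGhoulMasmoudi2021, §9 Proposition 9.2 (p. 20 of arXiv:1910.14071); Elgindi2021, §8.1 Lemma 8.5 and Remark 8.3 (p. 25 of arXiv:1904.04795)] -/
theorem eHkNormSq_mul_le_closure {α : ℝ} (hα : 0 < α) (hα10 : α ≤ 10) {f g : ℝ → ℝ → ℝ} {fs gs : ℕ → ℝ → ℝ → ℝ}
    (hf : HkApprox α f fs) (hg : HkApprox α g gs) :
    eHkNormSq α 4 (f * g) ≤ 4 * ENNReal.ofReal (30 * (25 * 65536 * 25) * (π / (3 * (gammaExp α - 1)))) * (eHkNormSq α 4 f * eHkNormSq α 4 g) := by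
  have h4 : (4 : WithTop ℕ∞) ≤ ((⊤ : ℕ∞) : WithTop ℕ∞) := WithTop.coe_le_coe.2 le_top
  set K : ℝ≥0∞ := ENNReal.ofReal (30 * (25 * 65536 * 25) * (π / (3 * (gammaExp α - 1)))) with hK
  -- common a.e.-convergent subsequence
  obtain ⟨ns, hns, haef⟩ := hf.exists_subseq_ae
  have hg' : HkApprox α g (gs ∘ ns) := hg.subseq hns
  obtain ⟨ms, hms, haeg⟩ := hg'.exists_subseq_ae
  have hf'' : HkApprox α f (fs ∘ ns ∘ ms) := (hf.subseq hns).subseq hms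
  have hg'' : HkApprox α g (gs ∘ ns ∘ ms) := hg'.subseq hms
  set hs : ℕ → ℝ → ℝ → ℝ := fun k => fs (ns (ms k)) * gs (ns (ms k)) with hhs
  -- words of `hs k` converge a.e. to those of `f g`
  have hlim : ∀ᵐ p ∂(volume.restrict strip), ∀ i j, i + j ≤ 4 →
      Tendsto (fun k => (Dθ^[i] (Dz^[j] (hs k))) p.1 p.2) atTop (𝓝 ((Dθ^[i] (Dz^[j] (f * g))) p.1 p.2)) := by
    filter_upwards [haef, haeg, (ae_restrict_iff' measurableSet_strip).2 (ae_of_all _ fun p (hp : p ∈ strip) => hp)] with p h1 h2 hp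
    intro i j hij
    have ef : ∀ k, (Dθ^[i] (Dz^[j] (hs k))) p.1 p.2 = ∑ a ∈ range (j + 1), ∑ b ∈ range (i + 1),
        ((j.choose a : ℝ) * (i.choose b : ℝ)) * ((Dθ^[b] (Dz^[a] (fs (ns (ms k))))) p.1 p.2 * (Dθ^[i - b] (Dz^[j - a] (gs (ns (ms k))))) p.1 p.2) := fun k =>
      iterate_Dθ_Dz_mul_apply (hf.test _).smooth (hg.test _).smooth i j p.1 p.2
    simp_rw [ef]
    rw [iterate_Dθ_Dz_mul_strip hf.smooth hg.smooth i j hp]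
    refine tendsto_finsetSum _ fun a ha => tendsto_finsetSum _ fun b hb => ?_
    have ha' : a ≤ j := Nat.lt_succ_iff.1 (mem_range.1 ha)
    have hb' : b ≤ i := Nat.lt_succ_iff.1 (mem_range.1 hb)
    have t1 := (h1 b a (by omega)).comp hms.tendsto_atTop
    have t2 := h2 (i - b) (j - a) (by omega)
    exact ((t1.mul t2).const_mul _)
  have hfg4 : ContDiffOn ℝ 4 (uncurry (f * g)) strip := ((hf.smooth.of_le h4).mul (hg.smooth.of_le h4)).congr fun p _ => rfl
  have hhs4 : ∀ k, ContDiffOn ℝ 4 (uncurry (hs k)) strip := fun k => (((hf.test _).mul (hg.test _)).smooth 4).contDiffOn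
  have hFatou := eHkNormSq_le_liminf_ae α hfg4 hhs4 hlim
  -- the test-function product rule along the subsequence
  have hk : ∀ k, eHkNormSq α 4 (hs k) ≤ K * ((2 * eHkNormSq α 4 f + 2 * eHkNormSq α 4 (fs (ns (ms k)) - f)) *
      (2 * eHkNormSq α 4 g + 2 * eHkNormSq α 4 (gs (ns (ms k)) - g))) := by
    intro k
    refine (eHkNormSq_mul_le hα hα10 (hf.test _) (hg.test _)).trans (mul_le_mul_right (mul_le_mul' ?_ ?_) _)
    · exact hf''.eHkNormSq_approx_le k
    · exact hg''.eHkNormSq_approx_le k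
  have hKtop : K ≠ ⊤ := ENNReal.ofReal_ne_top
  have hT := tendsto_rhs_mul hf.eHkNormSq_lt_top.ne hg.eHkNormSq_lt_top.ne hKtop hf''.conv hg''.conv
  calc eHkNormSq α 4 (f * g) ≤ liminf (fun k => eHkNormSq α 4 (hs k)) atTop := hFatou
    _ ≤ liminf (fun k => K * ((2 * eHkNormSq α 4 f + 2 * eHkNormSq α 4 (fs (ns (ms k)) - f)) * (2 * eHkNormSq α 4 g + 2 * eHkNormSq α 4 (gs (ns (ms k)) - g)))) atTop :=
        liminf_le_liminf (Eventually.of_forall hk)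
    _ = K * ((2 * eHkNormSq α 4 f) * (2 * eHkNormSq α 4 g)) := hT.liminf_eq
    _ = 4 * K * (eHkNormSq α 4 f * eHkNormSq α 4 g) := by ring

/-- **The radial words `D_z^jf`, `j ≤ 3`, against `sin(2θ)^{−γ}` on the closure**:
`∫∫ w²(D_z^jf)²s^{−γ} ≤ 2(π/(γ−1))²|f|²_{𝓗⁴}`. [folklore] -/
theorem lintegral_radialWord_le_closure {α : ℝ} (hα : 0 < α) (hα10 : α ≤ 10) {f : ℝ → ℝ → ℝ} {fs : ℕ → ℝ → ℝ → ℝ}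
    (hf : HkApprox α f fs) {j : ℕ} (hj : j ≤ 3) :
    ∫⁻ p in strip, ENNReal.ofReal (radialWeight p.1 ^ 2 * ((Dz^[j] f) p.1 p.2) ^ 2 * Real.sin (2 * p.2) ^ (-gammaExp α)) ≤
      2 * ENNReal.ofReal ((π / (gammaExp α - 1)) ^ 2) * eHkNormSq α 4 f := by
  have h4 : (4 : WithTop ℕ∞) ≤ ((⊤ : ℕ∞) : WithTop ℕ∞) := WithTop.coe_le_coe.2 le_top
  set C : ℝ≥0∞ := ENNReal.ofReal ((π / (gammaExp α - 1)) ^ 2)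
  obtain ⟨ns, hns, hae⟩ := hf.exists_subseq_ae
  have hf' : HkApprox α f (fs ∘ ns) := hf.subseq hns
  set G : ℕ → ℝ × ℝ → ℝ≥0∞ := fun k p => ENNReal.ofReal (radialWeight p.1 ^ 2 * ((Dz^[j] (fs (ns k))) p.1 p.2) ^ 2 * Real.sin (2 * p.2) ^ (-gammaExp α))
  have hGm : ∀ k, AEMeasurable (G k) (volume.restrict strip) := by
    intro k
    have c1 : Measurable fun q : ℝ × ℝ => (Dz^[j] (fs (ns k))) q.1 q.2 := ((hf.test _).smooth.ofWord 0 j 0).continuous.measurable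
    have c2 : Measurable fun q : ℝ × ℝ => radialWeight q.1 := by unfold radialWeight; fun_prop
    have c3 : Measurable fun q : ℝ × ℝ => Real.sin (2 * q.2) ^ (-gammaExp α) := by fun_prop
    exact (((c2.pow_const 2).mul (c1.pow_const 2)).mul c3).ennreal_ofReal.aemeasurable
  have hlim : ∀ᵐ p ∂(volume.restrict strip), Tendsto (fun k => G k p) atTop
      (𝓝 (ENNReal.ofReal (radialWeight p.1 ^ 2 * ((Dz^[j] f) p.1 p.2) ^ 2 * Real.sin (2 * p.2) ^ (-gammaExp α)))) := by
    filter_upwards [hae] with p hp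
    have h0 := hp 0 j (by omega)
    simp only [Function.iterate_zero, id_eq] at h0
    exact ENNReal.tendsto_ofReal (((h0.pow 2).const_mul _).mul_const _)
  have hk : ∀ k, ∫⁻ p in strip, G k p ≤ C * (2 * eHkNormSq α 4 f + 2 * eHkNormSq α 4 (fs (ns k) - f)) := fun k =>
    (lintegral_radialWord_rpow_neg_gamma_le hα hα10 (hf.test _) hj).trans (mul_le_mul_right (hf'.eHkNormSq_approx_le k) _)
  have hT : Tendsto (fun k => C * (2 * eHkNormSq α 4 f + 2 * eHkNormSq α 4 (fs (ns k) - f))) atTop (𝓝 (C * (2 * eHkNormSq α 4 f))) := by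
    have h1 : Tendsto (fun k => 2 * eHkNormSq α 4 f + 2 * eHkNormSq α 4 (fs (ns k) - f)) atTop (𝓝 (2 * eHkNormSq α 4 f + 2 * 0)) :=
      tendsto_const_nhds.add (ENNReal.Tendsto.const_mul hf'.conv (Or.inr (by norm_num)))
    rw [mul_zero, add_zero] at h1
    exact ENNReal.Tendsto.const_mul h1 (Or.inr ENNReal.ofReal_ne_top)
  calc ∫⁻ p in strip, ENNReal.ofReal (radialWeight p.1 ^ 2 * ((Dz^[j] f) p.1 p.2) ^ 2 * Real.sin (2 * p.2) ^ (-gammaExp α))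
      = ∫⁻ p in strip, liminf (fun k => G k p) atTop := lintegral_congr_ae (by filter_upwards [hlim] with p hp; exact hp.liminf_eq.symm)
    _ ≤ liminf (fun k => ∫⁻ p in strip, G k p) atTop := lintegral_liminf_le' hGm
    _ ≤ liminf (fun k => C * (2 * eHkNormSq α 4 f + 2 * eHkNormSq α 4 (fs (ns k) - f))) atTop := liminf_le_liminf (Eventually.of_forall hk)
    _ = C * (2 * eHkNormSq α 4 f) := hT.liminf_eq
    _ = 2 * C * eHkNormSq α 4 f := by ring

/-- A continuous function bounded a.e. on the strip is bounded there. [folklore] -/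
theorem le_of_ae_le_strip {h : ℝ × ℝ → ℝ} (hc : ContinuousOn h strip) {M : ℝ} (hae : ∀ᵐ p ∂(volume.restrict strip), h p ≤ M) :
    ∀ p ∈ strip, h p ≤ M := by
  by_contra hneg
  simp only [not_forall, not_le, exists_prop] at hneg
  obtain ⟨p₀, hp₀, hM⟩ := hneg
  obtain ⟨U, hU, hUeq⟩ := (continuousOn_iff'.1 hc) (Ioi M) isOpen_Ioi
  have hopen : IsOpen (U ∩ strip) := hU.inter isOpen_strip
  have hmem : p₀ ∈ U ∩ strip := by
    have : p₀ ∈ h ⁻¹' Ioi M ∩ strip := ⟨hM, hp₀⟩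
    rw [hUeq] at this; exact this
  have hpos : 0 < volume (U ∩ strip) := hopen.measure_pos volume ⟨p₀, hmem⟩
  have hzero : volume.restrict strip {p | ¬h p ≤ M} = 0 := ae_iff.1 hae
  have hsub : U ∩ strip ⊆ {p | ¬h p ≤ M} ∩ strip := by
    intro p hp
    have : p ∈ h ⁻¹' Ioi M ∩ strip := by rw [hUeq]; exact hp
    exact ⟨not_le.2 this.1, hp.2⟩
  have : volume (U ∩ strip) ≤ volume.restrict strip {p | ¬h p ≤ M} := by
    rw [Measure.restrict_apply' measurableSet_strip]; exact measure_mono hsub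
  rw [hzero] at this
  exact absurd (le_antisymm this bot_le) hpos.ne'

/-- **The `L^∞` bound of the low words on the closure** (Elgindi Corollary 8.2/8.4): for `a + b ≤ 2`,
`(D_θ^aD_z^bf)(z,θ)² ≤ 2π/(3(γ−1))·|f|²_{𝓗⁴}` at every point of the strip. [cite: Elgindi2021, §8.1 Corollaries 8.2 and 8.4 (p. 25 of arXiv:1904.04795)] -/
theorem sq_word_le_closure {α : ℝ} (hα : 0 < α) (hα10 : α ≤ 10) {f : ℝ → ℝ → ℝ} {fs : ℕ → ℝ → ℝ → ℝ}
    (hf : HkApprox α f fs) {a b : ℕ} (hab : a + b ≤ 2) {p : ℝ × ℝ} (hp : p ∈ strip) :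
    ENNReal.ofReal (((Dθ^[a] (Dz^[b] f)) p.1 p.2) ^ 2) ≤ 2 * ENNReal.ofReal (π / (3 * (gammaExp α - 1))) * eHkNormSq α 4 f := by
  have h4 : (4 : WithTop ℕ∞) ≤ ((⊤ : ℕ∞) : WithTop ℕ∞) := WithTop.coe_le_coe.2 le_top
  set c : ℝ≥0∞ := ENNReal.ofReal (π / (3 * (gammaExp α - 1)))
  set B : ℝ≥0∞ := 2 * c * eHkNormSq α 4 f with hB
  have hBtop : B ≠ ⊤ := ENNReal.mul_ne_top (ENNReal.mul_ne_top (by norm_num) ENNReal.ofReal_ne_top) hf.eHkNormSq_lt_top.ne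
  obtain ⟨ns, hns, hae⟩ := hf.exists_subseq_ae
  have hf' : HkApprox α f (fs ∘ ns) := hf.subseq hns
  have hT : Tendsto (fun k => c * (2 * eHkNormSq α 4 f + 2 * eHkNormSq α 4 (fs (ns k) - f))) atTop (𝓝 (c * (2 * eHkNormSq α 4 f))) := by
    have h1 : Tendsto (fun k => 2 * eHkNormSq α 4 f + 2 * eHkNormSq α 4 (fs (ns k) - f)) atTop (𝓝 (2 * eHkNormSq α 4 f + 2 * 0)) :=
      tendsto_const_nhds.add (ENNReal.Tendsto.const_mul hf'.conv (Or.inr (by norm_num)))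
    rw [mul_zero, add_zero] at h1
    exact ENNReal.Tendsto.const_mul h1 (Or.inr ENNReal.ofReal_ne_top)
  -- a.e. bound, then everywhere by continuity
  have haeB : ∀ᵐ q ∂(volume.restrict strip), ENNReal.ofReal (((Dθ^[a] (Dz^[b] f)) q.1 q.2) ^ 2) ≤ B := by
    filter_upwards [hae] with q hq
    have hlimq := ENNReal.tendsto_ofReal ((hq a b (by omega)).pow 2)
    have hk : ∀ k, ENNReal.ofReal (((Dθ^[a] (Dz^[b] (fs (ns k)))) q.1 q.2) ^ 2) ≤ c * (2 * eHkNormSq α 4 f + 2 * eHkNormSq α 4 (fs (ns k) - f)) := fun k =>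
      (sq_word_le_eHkNormSq hα hα10 (hf.test _) hab q.1 q.2).trans (mul_le_mul_right (hf'.eHkNormSq_approx_le k) _)
    have := le_of_tendsto_of_tendsto hlimq hT (Eventually.of_forall hk)
    rw [hB]; calc _ ≤ c * (2 * eHkNormSq α 4 f) := this
      _ = 2 * c * eHkNormSq α 4 f := by ring
  have haeR : ∀ᵐ q ∂(volume.restrict strip), ((Dθ^[a] (Dz^[b] f)) q.1 q.2) ^ 2 ≤ B.toReal := by
    filter_upwards [haeB] with q hq
    exact (ENNReal.ofReal_le_iff_le_toReal hBtop).1 hq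
  have hab4 : a + b ≤ 4 := by omega
  have hcont : ContinuousOn (fun q : ℝ × ℝ => ((Dθ^[a] (Dz^[b] f)) q.1 q.2) ^ 2) strip := (continuousOn_iterate_Dθ_Dz (N := 4) (i := a) (j := b) (hf.smooth.of_le h4) hab4).pow 2
  have hall := le_of_ae_le_strip hcont haeR p hp
  exact (ENNReal.ofReal_le_iff_le_toReal hBtop).2 hall

end Elgindi

end Literature.Analysis.FluidPDE
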